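import Summits.QuantumFields.YangMills.Theorems.FlatTubeReductionEigenWeightedIdentity
import Summits.QuantumFields.YangMills.Theorems.FlatTubeReductionDressedOneOrbitRatePrelim
import Summits.QuantumFields.YangMills.Theorems.FlatTubeReductionOffTubeSuppressionPrelim
import Summits.QuantumFields.YangMills.Theorems.LuscherReductionTwistedTraceScalingFloorTube
import Summits.QuantumFields.YangMills.Theorems.LuscherReductionRunningReductionPolyakovLine
import HarnessLib

/-!
# (EM) by the MOMENT BOOTSTRAP: `RateTube.OneSiteEigenMoments` ⟸ one-site OUTER COERCIVITY at the eigen-scale `R·λ_b`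
# (route `FlatTubeReduction`, crux K1 `NearFlatRatioLaw` stmt-QuantumFields-24720, skeleton «ratepack-v2» stub `stub_eigenMoments`; seat `ym-line-ftr-p1` g10;
# R2b1 RECORD rung — no summit statement is proved here)

(EM) says: the exact one-site eigenfunctions `K_Bφ = μ_jφ` of the low levels have `∫_{orbitDist<1/2} orbitDist²·φ² = O(λ_b²)‖φ‖²`.  THIS FILE reduces it to ONE localisation
estimate of crux-ONE type (B. Simon's valley confinement), but at the eigen-scale instead of `√λ_b`:

  (OC)  `∀ E', ∃ R B₁, ∀ B ≥ B₁, ∀ ψ physical with ψ = 0 on ⋃_z {orbitDist(τ_z ·) < Rλ_b(B)}:  ⟨ψ, K_B ψ⟩ ≤ (1 − E'λ_b(B))·λ₀(B)·‖ψ‖²`.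

MECHANISM (`eigenMoment_level_of_outerCoercive`): with the capped toron weight `w = min(d_tor, ½)` (link-Lipschitz 1, gauge/twist-invariant), the weighted-eigenfunction bound
(`eigen_weighted_le`, p663773) pins `⟨wφ,Kwφ⟩ ≥ μ‖wφ‖² − O(λ³λ₀)‖φ‖²` — the level deficit `λ₀ − μ = O(λλ₀)` (crux ONE `oneSiteLevels_proof`) multiplies `‖wφ‖²`, not `‖φ‖²`;
the radial IMS cut of `wφ` at `δ = 2Rλ` (`qform_le_inner_outer_lat`, defect `O(λλ₀/R²)‖wφ‖²`) has an inner piece of norm `≤ δ²‖φ‖²` and an outer piece on which (OC) gains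
`E'λλ₀`; with `E' = 2(C_j + 1)` the books close at `‖wφ‖² ≤ (8R² + c/(C_j+1))λ²‖φ‖²`, and `w = orbitDist` on `{orbitDist < ½}` at one site (the eight toron windows of radius `½`
are disjoint, `twist3_eq_of_orbitDist_lt`).  `oneSiteEigenMoments_of_outerCoercive` sums the per-level constants over `j ≤ m`.
HONEST FRAMING: (OC) is OPEN (an L-sized one-site valley bound at the eigen-scale; crux ONE's `valley_gain` is the `√λ_b`-scale analogue); femto rung R2b1 (RECORD label); not infinite
volume, not a gap, not Clay.  No defs, no named facts, no `sorry`.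
-/

set_option autoImplicit false

noncomputable section

open MeasureTheory Filter Topology Real
open scoped BigOperators
open Literature.MathematicalPhysics.QuantumFieldTheory
open Literature.MathematicalPhysics.QuantumLattice

namespace Summit.QuantumFields.YangMills.Theorems.FemtoTransferGap.RateTube

open Summit.QuantumFields.YangMills.Theorems.FemtoTransferGap

/-! ## §1 The capped toron weight `w = min(d_tor, ½)` -/

section Weight

variable {L : ℕ} [NeZero L]

/-- `w = min(d_tor, ½)` is link-Lipschitz with constant `1`. [folklore] -/
theorem abs_capTor_sub_le (U V : GaugeConfig 3 L SU2) :
    |min (torDist U) (1 / 2) - min (torDist V) (1 / 2)| ≤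
      1 * ∑ e, frobNorm (((U e : SU2) : Matrix (Fin 2) (Fin 2) ℂ) - ((V e : SU2) : Matrix (Fin 2) (Fin 2) ℂ)) := by
  rw [one_mul]
  refine (abs_min_sub_min_le_max _ _ _ _).trans ?_
  rw [sub_self, abs_zero, max_eq_left (abs_nonneg _)]
  exact abs_torDist_sub_le U V

/-- `0 ≤ w ≤ ½`, hence `|w| ≤ 1`. [folklore] -/
theorem abs_capTor_le_one (U : GaugeConfig 3 L SU2) : |min (torDist U) (1 / 2)| ≤ 1 := by
  rw [abs_of_nonneg (le_min (torDist_nonneg U) (by norm_num))]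
  exact (min_le_right _ _).trans (by norm_num)

/-- `w ≤ orbitDist(τ_z ·)` for every twist `z`. [folklore] -/
theorem capTor_le_orbitDist_twist3 (z : Fin 3 → Bool) (U : GaugeConfig 3 L SU2) : min (torDist U) (1 / 2) ≤ orbitDist (TT.twist3 z U) :=
  (min_le_left _ _).trans (torDist_le z U)

/-- `w` is measurable. [folklore] -/
theorem measurable_capTor : Measurable fun U : GaugeConfig 3 L SU2 => min (torDist U) (1 / 2) :=
  measurable_torDist.min measurable_const

end Weight

/-- At ONE SITE the eight toron windows of radius `½` are disjoint, so `w = orbitDist` on `{orbitDist < ½}`. [cite: tHooft1979] -/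
theorem capTor_eq_orbitDist_of_lt {U : GaugeConfig 3 1 SU2} (hU : orbitDist U < 1 / 2) : min (torDist U) (1 / 2) = orbitDist U := by
  have htor : torDist U = orbitDist U := by
    obtain ⟨z, hz⟩ := exists_torDist_eq U
    have hzlt : orbitDist (TT.twist3 z U) < 1 / 2 := by rw [← hz]; exact (torDist_le_orbitDist U).trans_lt hU
    have h0 : orbitDist (TT.twist3 (fun _ => false) U) < 1 / 2 := by rw [TT.twist3_false]; exact hU
    have hLr : ((1 : ℕ) : ℝ) * (1 / 2) < 2 := by norm_num
    have hzeq : z = fun _ => false := twist3_eq_of_orbitDist_lt hLr hzlt h0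
    rw [hz, hzeq, TT.twist3_false]
  rw [htor, min_eq_left hU.le]

/-! ## §2 ★★★ The per-level bootstrap -/

set_option maxHeartbeats 800000 in
/-- ★★★ **Per-level eigen-moment bound from OUTER COERCIVITY at the eigen-scale.**  If (OC) holds — for every `E'` there are `R > 0` and `B₁` such that every physical `ψ` vanishing on
`⋃_z {orbitDist(τ_z ·) < R·λ_b(B)}` has `⟨ψ,K_Bψ⟩ ≤ (1 − E'λ_b(B))·λ₀(B)·‖ψ‖²` for `B ≥ B₁` — then for every level `j` the exact eigenfunctions `K_Bφ = μ_j(B)φ` satisfy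
`∫_{orbitDist<½} orbitDist²φ² ≤ S_j·λ_b(B)²·‖φ‖²` eventually. [cite: SimonB1983DiscreteSpectrum, §3] [cite: Luscher1983, §2] -/
theorem eigenMoment_level_of_outerCoercive
    (hOC : ∀ E' : ℝ, ∃ R B₁ : ℝ, 0 < R ∧ ∀ B : ℝ, B₁ ≤ B → ∀ ψ : GaugeConfig 3 1 SU2 → ℝ, IsPhys ψ →
      (∀ U, ψ U ≠ 0 → ∀ z : Fin 3 → Bool, R * bareLambda B ≤ orbitDist (TT.twist3 z U)) →
        qform su2Rep B ψ ψ ≤ (1 - E' * bareLambda B) * levelValue su2Rep 1 B 0 * l2 ψ ψ)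
    (j : ℕ) :
    ∃ S B₀ : ℝ, 0 ≤ S ∧ ∀ B : ℝ, B₀ ≤ B → ∀ φ : GaugeConfig 3 1 SU2 → ℝ, IsPhys φ →
      transferApply B φ = levelValue su2Rep 1 B j • φ →
        ∫ u, (if orbitDist u < 1 / 2 then orbitDist u ^ 2 else 0) * φ u ^ 2 ∂configMeasure SU2 1 ≤ S * bareLambda B ^ 2 * l2 φ φ := by
  -- crux ONE at level `j`: the level deficit `λ₀ − μ_j ≤ C_m λ λ₀`
  obtain ⟨Cj, Bj, hj⟩ := oneSiteLevels_proof j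
  set Cm : ℝ := |levelGap j| + |Cj| with hCm
  have hCm0 : 0 ≤ Cm := by positivity
  -- the outer coercivity at `E' = 2(C_m + 1)`
  obtain ⟨R₀, B₁, hR₀, hoc⟩ := hOC (2 * (Cm + 1))
  set E : ℝ := (Fintype.card (Edge 3 1) : ℝ) with hE
  have hu := uniformFloorConst_pos (L := 1)
  set u : ℝ := uniformFloorConst 1 with hudef
  set R : ℝ := max R₀ (12 * π ^ 2 * E ^ 2 / u + 1) with hR
  have hRR₀ : R₀ ≤ R := le_max_left _ _
  have hR1 : 1 ≤ R := by
    have h0 : 0 ≤ 12 * π ^ 2 * E ^ 2 / u := by positivity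
    have h1 : 12 * π ^ 2 * E ^ 2 / u + 1 ≤ R := le_max_right _ _
    linarith
  have hR0 : 0 < R := by linarith
  have hRsq : 12 * π ^ 2 * E ^ 2 / u ≤ R ^ 2 := by
    have h1 : 12 * π ^ 2 * E ^ 2 / u + 1 ≤ R := le_max_right _ _
    nlinarith
  set c₃ : ℝ := 3 * E ^ 2 / (4 * u) with hc₃
  have hc₃0 : 0 ≤ c₃ := by positivity
  refine ⟨8 * R ^ 2 + c₃ / (Cm + 1), max (max Bj B₁) 2, by positivity, fun B hB φ hφ heig => ?_⟩
  have hBj : Bj ≤ B := ((le_max_left _ _).trans (le_max_left _ _)).trans hB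
  have hB₁ : B₁ ≤ B := ((le_max_right _ _).trans (le_max_left _ _)).trans hB
  have hB2 : 2 ≤ B := (le_max_right _ _).trans hB
  have hB0 : 0 < B := by linarith
  have hB1 : 1 ≤ B := by linarith
  set lam := bareLambda B with hlam
  have hlam0 : 0 < lam := bareLambda_pos' hB0
  have hlam1 : lam ≤ 1 := by
    have h2B : 2 / (1 : ℝ) ^ 3 ≤ B := by rw [one_pow, div_one]; exact hB2
    have h := bareLambda_cube_le (L := 1) (zero_lt_one : (0 : ℝ) < 1) h2B
    have e1B : ((1 : ℕ) : ℝ) ^ 3 * B = B := by simp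
    rw [e1B] at h
    exact h
  have hlamne : lam ≠ 0 := hlam0.ne'
  have hRne : R ≠ 0 := hR0.ne'
  have hune : u ≠ 0 := hu.ne'
  have hcube : B * lam ^ 3 = 2 := bareLambda_cube hB0
  set Λ := levelValue su2Rep 1 B 0 with hΛ
  set μ := levelValue su2Rep 1 B j with hμ
  obtain ⟨hΛ0, -, hlow⟩ := hj B hBj
  have hCE := (latCE_pos (L := 1) hB0.le).le
  have hfloor : u * latCE 1 B ≤ Λ := levelValue_zero_ge_uniform (L := 1) hB1
  -- the deficit
  have hdef : (1 - Cm * lam) * Λ ≤ μ := by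
    refine le_trans (mul_le_mul_of_nonneg_right ?_ hΛ0.le) hlow
    have h1 : levelGap j * lam + Cj * lam ^ 2 ≤ Cm * lam := by
      have ha : levelGap j * lam ≤ |levelGap j| * lam := mul_le_mul_of_nonneg_right (le_abs_self _) hlam0.le
      have hb : Cj * lam ^ 2 ≤ |Cj| * lam ^ 2 := mul_le_mul_of_nonneg_right (le_abs_self _) (sq_nonneg _)
      have hc : |Cj| * lam ^ 2 ≤ |Cj| * lam := by
        have : lam ^ 2 ≤ lam := by nlinarith
        exact mul_le_mul_of_nonneg_left this (abs_nonneg _)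
      rw [hCm]; linarith
    have h2 := Real.add_one_le_exp (-(levelGap j * lam + Cj * lam ^ 2))
    linarith
  -- the weighted function `ψ = wφ`
  set w : GaugeConfig 3 1 SU2 → ℝ := fun U => min (torDist U) (1 / 2) with hw
  have hwg : ∀ (g : Site 3 1 → SU2) (U : GaugeConfig 3 1 SU2), w (gaugeTransform g U) = w U := fun g U => by
    simp only [hw, torDist_gaugeTransform]
  have hwz : ∀ (k : Fin 3), ∀ z ∈ Subgroup.center SU2, ∀ U : GaugeConfig 3 1 SU2, w (twist k z U) = w U := fun k z hz U => by
    simp only [hw, torDist_twist k hz]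
  have hw1 : ∀ U, |w U| ≤ 1 := fun U => abs_capTor_le_one U
  have hwm : Measurable w := measurable_capTor
  have hψ : IsPhys fun U => w U * φ U := hφ.mul_of_invariant hwm hw1 hwg hwz
  -- (A) the weighted-eigenfunction bound, defect row `≤ E²·(3/B)·c_B`
  have hMw : ∀ U : GaugeConfig 3 1 SU2, ∫ V, transferKernel su2Rep B U V * (w U - w V) ^ 2 ∂configMeasure SU2 1 ≤ E ^ 2 * 1 ^ 2 * (3 / B) * latCE 1 B :=
    fun U => defectRow_le_of_pos_lat hB0 (fun U V => abs_capTor_sub_le U V) U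
  have hA := eigen_weighted_le B hφ heig hwm hw1 hwg hwz hMw
  -- the radial IMS cut of `ψ` at `δ = 2Rλ`
  set δ : ℝ := 2 * R * lam with hδ
  have hδ0 : 0 < δ := by positivity
  have hims := qform_le_inner_outer_lat hB0 hδ0 hψ
  have hcP : IsPhys fun U => Real.cos (innerPhase δ U) * (w U * φ U) := isPhys_inner δ hψ
  have hsP : IsPhys fun U => Real.sin (innerPhase δ U) * (w U * φ U) := isPhys_outer δ hψ
  -- inner piece: top of the spectrum; outer piece: (OC)
  have hin : qform su2Rep B (fun U => Real.cos (innerPhase δ U) * (w U * φ U)) (fun U => Real.cos (innerPhase δ U) * (w U * φ U))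
      ≤ Λ * l2 (fun U => Real.cos (innerPhase δ U) * (w U * φ U)) (fun U => Real.cos (innerPhase δ U) * (w U * φ U)) := by
    rw [hΛ, levelValue_zero]; exact OffTube.qform_le_topValue_mul_l2 hB0.le hcP
  have hout : qform su2Rep B (fun U => Real.sin (innerPhase δ U) * (w U * φ U)) (fun U => Real.sin (innerPhase δ U) * (w U * φ U))
      ≤ (1 - 2 * (Cm + 1) * lam) * Λ * l2 (fun U => Real.sin (innerPhase δ U) * (w U * φ U)) (fun U => Real.sin (innerPhase δ U) * (w U * φ U)) := by
    refine hoc B hB₁ _ hsP fun U hU z => ?_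
    have hU' : Real.sin (innerPhase δ U) * (w U * φ U) ≠ 0 := hU
    have hs : Real.sin (innerPhase δ U) ≠ 0 := left_ne_zero_of_mul hU'
    have h := forall_lt_orbitDist_of_sin_ne_zero hδ0 hs z
    have e : δ / 2 = R * lam := by rw [hδ]; ring
    rw [e] at h
    have : R₀ * lam ≤ R * lam := mul_le_mul_of_nonneg_right hRR₀ hlam0.le
    linarith
  -- norms
  set N : ℝ := l2 (fun U => w U * φ U) (fun U => w U * φ U) with hN
  set nc : ℝ := l2 (fun U => Real.cos (innerPhase δ U) * (w U * φ U)) (fun U => Real.cos (innerPhase δ U) * (w U * φ U)) with hnc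
  set ns : ℝ := l2 (fun U => Real.sin (innerPhase δ U) * (w U * φ U)) (fun U => Real.sin (innerPhase δ U) * (w U * φ U)) with hns
  set F : ℝ := l2 φ φ with hF
  have hN0 : 0 ≤ N := l2_self_nonneg_lat _
  have hnc0 : 0 ≤ nc := l2_self_nonneg_lat _
  have hns0 : 0 ≤ ns := l2_self_nonneg_lat _
  have hF0 : 0 ≤ F := l2_self_nonneg_lat _
  have hsum : nc + ns = N := l2_cos_add_l2_sin (measurable_innerPhase δ) hψ
  -- the inner piece has norm `≤ δ²‖φ‖²` (`w ≤ δ` where `cos Θ_δ ≠ 0`)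
  have hncF : nc ≤ δ ^ 2 * F := by
    have e1 : nc = ∫ U, (Real.cos (innerPhase δ U) * (w U * φ U)) ^ 2 ∂configMeasure SU2 1 := by simp only [hnc, l2, pow_two]
    have e2 : δ ^ 2 * F = ∫ U, δ ^ 2 * φ U ^ 2 ∂configMeasure SU2 1 := by
      simp only [hF, l2, pow_two]; rw [integral_const_mul]
    rw [e1, e2]
    refine integral_mono hcP.integrable_sq ((hφ.integrable_sq).const_mul _) fun U => ?_
    simp only
    by_cases hc : Real.cos (innerPhase δ U) = 0
    · rw [hc, zero_mul, zero_pow two_ne_zero]; positivity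
    · obtain ⟨z, hz⟩ := exists_orbitDist_lt_of_cos_ne_zero hδ0 hc
      have hwδ : w U ≤ δ := (capTor_le_orbitDist_twist3 z U).trans hz.le
      have hw0 : 0 ≤ w U := le_min (torDist_nonneg U) (by norm_num)
      have hc1 : Real.cos (innerPhase δ U) ^ 2 ≤ 1 := Real.cos_sq_le_one _
      have hw2 : w U ^ 2 ≤ δ ^ 2 := pow_le_pow_left₀ hw0 hwδ 2
      calc (Real.cos (innerPhase δ U) * (w U * φ U)) ^ 2 = Real.cos (innerPhase δ U) ^ 2 * (w U ^ 2 * φ U ^ 2) := by ring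
        _ ≤ 1 * (δ ^ 2 * φ U ^ 2) :=
            mul_le_mul hc1 (mul_le_mul_of_nonneg_right hw2 (sq_nonneg _)) (by positivity) zero_le_one
        _ = δ ^ 2 * φ U ^ 2 := one_mul _
  -- the two defect constants in `λ` units
  have h3B : 3 / B = 3 / 2 * lam ^ 3 := by
    rw [div_eq_iff hB0.ne']; linear_combination (-(3 / 2) : ℝ) * hcube
  have hMd : (1 / 2) * (E ^ 2 * (8 * π / δ) ^ 2 * (3 / B) * latCE 1 B) ≤ lam * Λ := by
    have e : (1 / 2) * (E ^ 2 * (8 * π / δ) ^ 2 * (3 / B) * latCE 1 B) = 12 * π ^ 2 * E ^ 2 / R ^ 2 * (lam * latCE 1 B) := by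
      rw [h3B, hδ]; field_simp; ring
    rw [e]
    have h1 : 12 * π ^ 2 * E ^ 2 / R ^ 2 ≤ u := by
      rw [div_le_iff₀ (by positivity)]
      have := (div_le_iff₀ hu).mp hRsq
      linarith
    calc 12 * π ^ 2 * E ^ 2 / R ^ 2 * (lam * latCE 1 B) ≤ u * (lam * latCE 1 B) := mul_le_mul_of_nonneg_right h1 (by positivity)
      _ = lam * (u * latCE 1 B) := by ring
      _ ≤ lam * Λ := mul_le_mul_of_nonneg_left hfloor hlam0.le
  have hMwb : (1 / 2) * (E ^ 2 * 1 ^ 2 * (3 / B) * latCE 1 B) ≤ c₃ * lam ^ 3 * Λ := by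
    have e : (1 / 2) * (E ^ 2 * 1 ^ 2 * (3 / B) * latCE 1 B) = c₃ * lam ^ 3 * (u * latCE 1 B) := by
      rw [h3B, hc₃]; field_simp; ring
    rw [e]
    exact mul_le_mul_of_nonneg_left hfloor (by positivity)
  -- bookkeeping
  have hqψ : μ * N ≤ Λ * nc + (1 - 2 * (Cm + 1) * lam) * Λ * ns + lam * Λ * N + c₃ * lam ^ 3 * Λ * F := by
    have h1 := mul_le_mul_of_nonneg_right hMd hN0
    have h2 := mul_le_mul_of_nonneg_right hMwb hF0
    linarith [hA, hims, hin, hout]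
  have hdefN : (1 - Cm * lam) * Λ * N ≤ μ * N := mul_le_mul_of_nonneg_right hdef hN0
  have hΛsum : Λ * nc + Λ * ns = Λ * N := by rw [← hsum]; ring
  -- `2(Cm+1)·λΛ·ns ≤ (Cm+1)·λΛ·N + c₃λ³Λ F`
  have hkey : 2 * (Cm + 1) * (lam * Λ * ns) ≤ (Cm + 1) * (lam * Λ * N) + c₃ * lam ^ 3 * Λ * F := by linarith [hqψ, hdefN, hΛsum]
  have hlamN : lam * Λ * N = lam * Λ * nc + lam * Λ * ns := by rw [← hsum]; ring
  have hlamnc : lam * Λ * nc ≤ 4 * R ^ 2 * (lam ^ 3 * Λ * F) := by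
    have := mul_le_mul_of_nonneg_left hncF (mul_nonneg hlam0.le hΛ0.le)
    have e : lam * Λ * (δ ^ 2 * F) = 4 * R ^ 2 * (lam ^ 3 * Λ * F) := by rw [hδ]; ring
    linarith
  have hCm1 : 0 < Cm + 1 := by linarith
  have hns_b : lam * Λ * ns ≤ 4 * R ^ 2 * (lam ^ 3 * Λ * F) + c₃ / (Cm + 1) * (lam ^ 3 * Λ * F) := by
    have h1 : (Cm + 1) * (lam * Λ * ns) ≤ (Cm + 1) * (4 * R ^ 2 * (lam ^ 3 * Λ * F)) + c₃ * (lam ^ 3 * Λ * F) := by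
      have := mul_le_mul_of_nonneg_left hlamnc hCm1.le
      have hlamN' : (Cm + 1) * (lam * Λ * N) = (Cm + 1) * (lam * Λ * nc) + (Cm + 1) * (lam * Λ * ns) := by rw [hlamN]; ring
      linarith [hkey, hlamN']
    have h2 : (Cm + 1) * (lam * Λ * ns) ≤ (Cm + 1) * (4 * R ^ 2 * (lam ^ 3 * Λ * F) + c₃ / (Cm + 1) * (lam ^ 3 * Λ * F)) := by
      have e : (Cm + 1) * (4 * R ^ 2 * (lam ^ 3 * Λ * F) + c₃ / (Cm + 1) * (lam ^ 3 * Λ * F))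
          = (Cm + 1) * (4 * R ^ 2 * (lam ^ 3 * Λ * F)) + c₃ * (lam ^ 3 * Λ * F) := by field_simp
      rw [e]; exact h1
    exact le_of_mul_le_mul_left h2 hCm1
  have hNb : lam * Λ * N ≤ (8 * R ^ 2 + c₃ / (Cm + 1)) * (lam ^ 3 * Λ * F) := by linarith [hlamN, hlamnc, hns_b]
  have hNfin : N ≤ (8 * R ^ 2 + c₃ / (Cm + 1)) * lam ^ 2 * F := by
    have hpos : 0 < lam * Λ := mul_pos hlam0 hΛ0
    have e : (8 * R ^ 2 + c₃ / (Cm + 1)) * (lam ^ 3 * Λ * F) = (lam * Λ) * ((8 * R ^ 2 + c₃ / (Cm + 1)) * lam ^ 2 * F) := by ring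
    rw [e, show lam * Λ * N = (lam * Λ) * N by ring] at hNb
    exact le_of_mul_le_mul_left hNb hpos
  -- the moment integrand is dominated by `(wφ)²`
  refine le_trans ?_ hNfin
  have eN : N = ∫ U, (w U * φ U) ^ 2 ∂configMeasure SU2 1 := by simp only [hN, l2, pow_two]
  rw [eN]
  refine integral_mono_of_nonneg (ae_of_all _ fun U => ?_) hψ.integrable_sq (ae_of_all _ fun U => ?_)
  · show (0 : ℝ) ≤ (if orbitDist U < 1 / 2 then orbitDist U ^ 2 else 0) * φ U ^ 2
    split_ifs <;> positivity
  · show (if orbitDist U < 1 / 2 then orbitDist U ^ 2 else 0) * φ U ^ 2 ≤ (w U * φ U) ^ 2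
    split_ifs with hlt
    · have hwU : w U = orbitDist U := capTor_eq_orbitDist_of_lt hlt
      rw [hwU]; exact le_of_eq (by ring)
    · rw [zero_mul]; positivity

/-! ## §3 ★★★ (EM) from (OC) -/

/-- ★★★ **(EM) ⟸ (OC)**: `RateTube.OneSiteEigenMoments` follows from the one-site outer coercivity at the eigen-scale (sum of the per-level constants over `j ≤ m`).
[cite: SimonB1983DiscreteSpectrum, §3] [cite: Luscher1983, §2] -/
theorem oneSiteEigenMoments_of_outerCoercive
    (hOC : ∀ E' : ℝ, ∃ R B₁ : ℝ, 0 < R ∧ ∀ B : ℝ, B₁ ≤ B → ∀ ψ : GaugeConfig 3 1 SU2 → ℝ, IsPhys ψ →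
      (∀ U, ψ U ≠ 0 → ∀ z : Fin 3 → Bool, R * bareLambda B ≤ orbitDist (TT.twist3 z U)) →
        qform su2Rep B ψ ψ ≤ (1 - E' * bareLambda B) * levelValue su2Rep 1 B 0 * l2 ψ ψ) :
    OneSiteEigenMoments := by
  intro m
  choose S B₀ hS0 hS using fun j => eigenMoment_level_of_outerCoercive hOC j
  refine ⟨∑ j ∈ Finset.range (m + 1), S j, ∑ j ∈ Finset.range (m + 1), |B₀ j|, Finset.sum_nonneg fun j _ => hS0 j, fun B hB φ hφ hφe => ?_⟩
  obtain ⟨j, hjm, heig⟩ := hφe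
  have hjmem : j ∈ Finset.range (m + 1) := Finset.mem_range.mpr (Nat.lt_succ_of_le hjm)
  have hBj : B₀ j ≤ B := le_trans ((le_abs_self _).trans (Finset.single_le_sum (fun i _ => abs_nonneg (B₀ i)) hjmem)) hB
  have hSj : S j ≤ ∑ i ∈ Finset.range (m + 1), S i := Finset.single_le_sum (fun i _ => hS0 i) hjmem
  refine (hS j B hBj φ hφ heig).trans ?_
  exact mul_le_mul_of_nonneg_right (mul_le_mul_of_nonneg_right hSj (sq_nonneg _)) (l2_self_nonneg_lat φ)

end Summit.QuantumFields.YangMills.Theorems.FemtoTransferGap.RateTube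

end
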